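import Mathlib.Analysis.InnerProductSpace.PiL2
import Mathlib.Analysis.InnerProductSpace.Projection.FiniteDimensional
import Mathlib.LinearAlgebra.Matrix.Determinant.Basic
import HarnessLib

/-!
# Orthonormal coordinates in the plane orthogonal to a unit vector of `ℝ³`

HONEST FRAMING. Part of the venture `Summits/Ventures/Crystal3D` (cell `crystal3d-full`). Linear
algebra in `ℝ³`; nothing about packings.

**Theorem** (`exists_planeCoordinates`; step (L3)(c) of the cell's P1-SPEC-A = `LatticeNoGain` at a
general normal, HOME/eng/MEMO-3.md ADDENDUM K).  Let `ν ∈ ℝ³` be a unit vector and `X, Y, c ⊥ ν`.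
There are a real `2 × 2` matrix `A` and a vector `β ∈ ℝ²` such that for all real `a, b`
`‖c + a X + b Y‖² = ((A (a,b))₀ + β₀)² + ((A (a,b))₁ + β₁)²`, with `(det A)² = ‖X‖²‖Y‖² − ⟪X, Y⟫²`
(the Gram determinant) and `|A f|² = ‖f₀ X + f₁ Y‖²` for every `f ∈ ℝ²`.  (Take an orthonormal
basis `e₀, e₁` of `(ℝ ∙ ν)ᗮ`, which has dimension `2`, and `A_{ij} = ⟪e_i, X_j⟫`, `β_i = ⟪e_i, c⟫`;
Parseval in the plane and the Lagrange identity.)  This turns the count of bond lines whose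
mid-plane crossing lies in a disc (`SlabTransversal.lean`) into the hypothesis of
`affine_disc_count` (`AffineDiscCount.lean`).

WHAT THIS IS NOT: the per-direction Gram identities of the fcc bond families (not done here).
-/

noncomputable section

namespace Summit.Ventures.Crystal3D

open RealInnerProductSpace Module

/-- **Orthonormal coordinates in `ν^⊥`.** For a unit vector `ν` of `ℝ³` and `X, Y, c ⊥ ν` there
are `A : Matrix (Fin 2) (Fin 2) ℝ` and `β : Fin 2 → ℝ` with
`‖c + a•X + b•Y‖² = (A (a,b) + β)₀² + (A (a,b) + β)₁²` for all `a b`, `(det A)² = ‖X‖²‖Y‖² − ⟪X,Y⟫²`,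
and `(A f)₀² + (A f)₁² = ‖f 0 • X + f 1 • Y‖²` for all `f`. -/
theorem exists_planeCoordinates (ν X Y c : EuclideanSpace ℝ (Fin 3)) (hν : ‖ν‖ = 1)
    (hX : ⟪X, ν⟫ = 0) (hY : ⟪Y, ν⟫ = 0) (hc : ⟪c, ν⟫ = 0) :
    ∃ (A : Matrix (Fin 2) (Fin 2) ℝ) (β : Fin 2 → ℝ),
      (∀ a b : ℝ, ‖c + a • X + b • Y‖ ^ 2 =
        (A.mulVec ![a, b] 0 + β 0) ^ 2 + (A.mulVec ![a, b] 1 + β 1) ^ 2) ∧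
      A.det ^ 2 = ‖X‖ ^ 2 * ‖Y‖ ^ 2 - ⟪X, Y⟫ ^ 2 ∧
      (∀ f : Fin 2 → ℝ, (A.mulVec f 0) ^ 2 + (A.mulVec f 1) ^ 2 = ‖f 0 • X + f 1 • Y‖ ^ 2) := by
  classical
  -- the plane `K = ν^⊥` has dimension two
  have hν0 : ν ≠ 0 := by
    intro h; rw [h, norm_zero] at hν; exact zero_ne_one hν
  haveI : Fact (finrank ℝ (EuclideanSpace ℝ (Fin 3)) = 2 + 1) := ⟨by simp⟩
  set K : Submodule ℝ (EuclideanSpace ℝ (Fin 3)) := (ℝ ∙ ν)ᗮ with hKdef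
  have hK : finrank ℝ K = 2 := Submodule.finrank_orthogonal_span_singleton hν0
  -- an orthonormal basis of `K` indexed by `Fin 2`
  let B : OrthonormalBasis (Fin 2) ℝ K := (stdOrthonormalBasis ℝ K).reindex (finCongr hK)
  -- membership in `K`
  have memK : ∀ z : EuclideanSpace ℝ (Fin 3), ⟪z, ν⟫ = 0 → z ∈ K := fun z hz =>
    Submodule.mem_orthogonal_singleton_iff_inner_left.2 hz
  -- coordinates
  refine ⟨!![⟪(B 0 : EuclideanSpace ℝ (Fin 3)), X⟫, ⟪(B 0 : EuclideanSpace ℝ (Fin 3)), Y⟫;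
           ⟪(B 1 : EuclideanSpace ℝ (Fin 3)), X⟫, ⟪(B 1 : EuclideanSpace ℝ (Fin 3)), Y⟫],
    ![⟪(B 0 : EuclideanSpace ℝ (Fin 3)), c⟫, ⟪(B 1 : EuclideanSpace ℝ (Fin 3)), c⟫], ?_, ?_, ?_⟩
  · -- Parseval in `K` for `c + aX + bY`
    intro a b
    have hz : c + a • X + b • Y ∈ K := by
      apply memK
      rw [inner_add_left, inner_add_left, inner_smul_left, inner_smul_left, hX, hY, hc]
      simp
    have hpar := B.sum_sq_inner_right ⟨c + a • X + b • Y, hz⟩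
    rw [Fin.sum_univ_two, Submodule.coe_inner, Submodule.coe_inner] at hpar
    simp only [Submodule.coe_norm] at hpar
    rw [← hpar]
    simp [Matrix.mulVec, dotProduct, Fin.sum_univ_two, inner_add_right, inner_smul_right]
    ring
  · -- Lagrange identity + Parseval for `X`, `Y`, `⟪X, Y⟫`
    have hXK : X ∈ K := memK X hX
    have hYK : Y ∈ K := memK Y hY
    have hpX := B.sum_sq_inner_right ⟨X, hXK⟩
    have hpY := B.sum_sq_inner_right ⟨Y, hYK⟩
    have hpXY := B.sum_inner_mul_inner ⟨X, hXK⟩ ⟨Y, hYK⟩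
    rw [Fin.sum_univ_two] at hpX hpY hpXY
    simp only [Submodule.coe_inner, Submodule.coe_norm] at hpX hpY hpXY
    rw [Matrix.det_fin_two_of, ← hpX, ← hpY, ← hpXY]
    have e0 : ⟪X, ((B 0 : K) : EuclideanSpace ℝ (Fin 3))⟫ = ⟪((B 0 : K) : EuclideanSpace ℝ (Fin 3)), X⟫ :=
      real_inner_comm _ _
    have e1 : ⟪X, ((B 1 : K) : EuclideanSpace ℝ (Fin 3))⟫ = ⟪((B 1 : K) : EuclideanSpace ℝ (Fin 3)), X⟫ :=
      real_inner_comm _ _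
    rw [e0, e1]
    ring
  · -- Parseval in `K` for `f 0 • X + f 1 • Y`
    intro f
    have hz : f 0 • X + f 1 • Y ∈ K := by
      apply memK
      rw [inner_add_left, inner_smul_left, inner_smul_left, hX, hY]
      simp
    have hpar := B.sum_sq_inner_right ⟨f 0 • X + f 1 • Y, hz⟩
    rw [Fin.sum_univ_two, Submodule.coe_inner, Submodule.coe_inner] at hpar
    simp only [Submodule.coe_norm] at hpar
    rw [← hpar]
    simp [Matrix.mulVec, dotProduct, Fin.sum_univ_two, inner_add_right, inner_smul_right]
    ring

end Summit.Ventures.Crystal3D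

end
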